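import Mathlib
import Summits.NavierStokesRegularity.NavierStokesRegularity.Theorems.EulerZoomLiouvillePowerGaugeEulerLiouvilleSelfSimilarEndpointPressure
import HarnessLib

/-!
# Rung C1 of the crux `EulerZoomLiouville.PowerGaugeEulerLiouville` at the endpoint `ρ = 1/2`:
# the pressure term on a dyadic shell with the mid Riesz source in `L⁴` (no sup bound)

Route №10 `EulerZoomLiouville` (NavierStokesRegularity), crux E = stmt-NavierStokesRegularity-19832,
registered open stub `stub_selfSimilarWeakRest`, endpoint `ρ = 1/2`.  The tree's `shell_pressure_le`
(`…SelfSimilarEndpointPressure`; Chae–Shvydkoy 2013, proof of Thm 3.1, the pressure terms of (3.3))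
bounds `∫_{S_L} |P| ‖V‖` for a profile `V ∈ L² ∩ L³_loc` whose pressure below `|y| < 16L` is the Riesz
pressure of `V·1_{B_{32L}}` plus the honest kernel integral of the sources `|z| ≥ 32L`, using the
POINTWISE growth bound `‖V‖ ≤ C_up|y|^{1−δ}` for exactly one purpose: to put the mid source
`V·1_{T_L}`, `T_L = {L/8 ≤ |y| < 32L}`, in `L⁴` with `‖V·1_T‖₄² ≤ sup_T‖V‖ · ‖V‖_{L²(T)}`.  This file
keeps `‖V·1_T‖₄²` itself in the bound:

* `EndpointSobolev.setIntegral_abs_rieszPressure_mul_norm_le_of_memLp_four` — mid sources by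
  Calderón–Zygmund in `L²`: `∫_S |Π[V·1_T]| ‖V‖ ≤ C_S √(∫_T ‖V‖⁴) √(∫_S ‖V‖²)` for `V·1_T ∈ L³ ∩ L⁴`;
* `EndpointSobolev.shell_pressure_le_of_memLp_four` — the tree's `shell_pressure_le` VERBATIM except
  that the hypotheses `(hδ1) (hCup) (hup) (hLR)` are replaced by `V·1_{T_L} ∈ L⁴` and the first term of
  the conclusion reads `C_S √(∫_{T_L} ‖V‖⁴) √(∫_{S_L} ‖V‖²)` (near and far sources untouched:
  `2 N_L √(vol B̄_{8L}) √(∫_{S_L} ‖V‖²)`, `N_L = ‖V‖₂²/(2π (L/8)³)`).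

In Seregin's class `√(∫_T ‖V‖⁴) ≤ (∫_T‖V‖⁶)^{1/4} (∫_T‖V‖²)^{1/4} ≲ L^{3/8} e_T^{1/4}` by the local
Sobolev inequality for the weak gradient (`…SelfSimilarEndpointSobolevTools`), which feeds the
growth-free recursion of `…SelfSimilarEndpointSobolevIteration`.

WHAT THIS IS NOT: not NS, not E, not the stub — the pressure input of one endpoint stratum, with one
hypothesis of the tree's lemma generalised. [cite: ChaeShvydkoy2013, §3.1 proof of Thm. 3.1]
-/

noncomputable section

-- flat `Theorems/<Route><Decl>…` files of one crux share the namespace of the crux (tree convention)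
set_option linter.dupNamespace false

open MeasureTheory Set Filter Topology Metric Function
open scoped ENNReal NNReal InnerProductSpace RealInnerProductSpace

namespace Summit.NavierStokesRegularity.NavierStokesRegularity.Theorems.PowerGaugeEulerLiouville

open Literature.Analysis Literature.Analysis.FluidPDE

namespace EndpointSobolev

section Mid

variable {V : EuclideanSpace ℝ (Fin 3) → EuclideanSpace ℝ (Fin 3)}

/-- **Mid sources: Calderón–Zygmund in `L²`, without a sup bound.**  Let `C_S` be a constant in
Stein's bound `‖Π[w]‖₂ ≤ C_S ‖w‖₄²` (`exists_eLpNorm_rieszPressure_two_le`), `S ⊆ T`, `T`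
measurable, `V·1_T ∈ L³ ∩ L⁴` and `‖V‖² ∈ L¹(T)`.  Then
`∫_S |Π[V·1_T]| ‖V‖ ≤ C_S √(∫_T ‖V‖⁴) √(∫_S ‖V‖²)`
(Cauchy–Schwarz on `S`, Stein's bound).  The tree's `setIntegral_abs_rieszPressure_mul_norm_le` is the
case `‖V‖ ≤ M` on `T`, where `√(∫_T ‖V‖⁴) ≤ M √(∫_T ‖V‖²)`.
[cite: ChaeShvydkoy2013, §3.1 proof of Thm. 3.1 (the term q₂)] -/
theorem setIntegral_abs_rieszPressure_mul_norm_le_of_memLp_four {C_S : ℝ≥0}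
    (hCS : ∀ w : EuclideanSpace ℝ (Fin 3) → EuclideanSpace ℝ (Fin 3), MemLp w 3 volume →
      MemLp w 4 volume → eLpNorm (rieszPressure w) 2 volume ≤ C_S * eLpNorm w 4 volume ^ 2)
    (hVm : AEStronglyMeasurable V volume) {S T : Set (EuclideanSpace ℝ (Fin 3))}
    (hT : MeasurableSet T) (hST : S ⊆ T)
    (hU3 : MemLp (T.indicator V) 3 volume) (hU4 : MemLp (T.indicator V) 4 volume)
    (hV2T : IntegrableOn (fun y => ‖V y‖ ^ 2) T volume) :
    ∫ y in S, |rieszPressure (T.indicator V) y| * ‖V y‖ ≤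
      C_S * Real.sqrt (∫ y in T, ‖V y‖ ^ 4) * Real.sqrt (∫ y in S, ‖V y‖ ^ 2) := by
  set U := T.indicator V with hU
  set Q := rieszPressure U with hQ
  have hQm : AEStronglyMeasurable Q volume := aestronglyMeasurable_rieszPressure hU3
  have hbound := hCS U hU3 hU4
  have hQ2 : MemLp Q 2 volume := by
    refine ⟨hQm, lt_of_le_of_lt hbound ?_⟩
    exact ENNReal.mul_lt_top ENNReal.coe_lt_top (ENNReal.pow_lt_top hU4.eLpNorm_lt_top)
  have hV2S : MemLp V 2 (volume.restrict S) :=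
    (memLp_two_iff_integrable_sq_norm hVm.restrict).2 (hV2T.mono_set hST)
  set eS : ℝ := ∫ y in S, ‖V y‖ ^ 2 with heS
  -- (1) Cauchy–Schwarz on `S`
  have h1 : ∫ y in S, |Q y| * ‖V y‖ ≤ Real.sqrt (∫ y in S, Q y ^ 2) * Real.sqrt eS :=
    setIntegral_abs_mul_norm_le_sqrt (hQ2.restrict S) hV2S
  -- (2) `∫_S Q² ≤ ∫ Q²`
  have hQsq : Integrable (fun y => Q y ^ 2) volume := (memLp_two_iff_integrable_sq hQm).1 hQ2
  have h2 : Real.sqrt (∫ y in S, Q y ^ 2) ≤ Real.sqrt (∫ y, Q y ^ 2) :=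
    Real.sqrt_le_sqrt (setIntegral_le_integral hQsq (Eventually.of_forall fun y => by positivity))
  -- (3) Stein
  have h3 : Real.sqrt (∫ y, Q y ^ 2) ≤ C_S * Real.sqrt (∫ y, ‖U y‖ ^ 4) :=
    sqrt_integral_sq_le_of_eLpNorm_le hQ2 hU4 hbound
  -- (4) `∫ ‖U‖⁴ = ∫_T ‖V‖⁴`
  have h4 : ∫ y, ‖U y‖ ^ 4 = ∫ y in T, ‖V y‖ ^ 4 := by
    rw [hU, integral_norm_indicator_pow hT (by norm_num)]
  calc ∫ y in S, |Q y| * ‖V y‖ ≤ Real.sqrt (∫ y in S, Q y ^ 2) * Real.sqrt eS := h1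
    _ ≤ (C_S * Real.sqrt (∫ y, ‖U y‖ ^ 4)) * Real.sqrt eS :=
        mul_le_mul_of_nonneg_right (h2.trans h3) (Real.sqrt_nonneg _)
    _ = C_S * Real.sqrt (∫ y in T, ‖V y‖ ^ 4) * Real.sqrt eS := by rw [h4]

end Mid

section Shell

variable {V : EuclideanSpace ℝ (Fin 3) → EuclideanSpace ℝ (Fin 3)} {P : EuclideanSpace ℝ (Fin 3) → ℝ}

/-- **The pressure term on the shell, mid source in `L⁴`** (`S_L = {L/4 ≤ |y| ≤ 8L}`): for
`V ∈ L² ∩ L³_loc`, `|P|‖V‖ ∈ L¹_loc`, a Stein constant `C_S`, a scale `L > 0` with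
`V·1_{T_L} ∈ L⁴`, `T_L = {L/8 ≤ |y| < 32L}`, and the Riesz representation of `P` below `|y| < 16L` at
source scale `32L`:
`∫_{S_L} |P| ‖V‖ ≤ C_S √(∫_{T_L} ‖V‖⁴) √(∫_{S_L} ‖V‖²) + 2 N_L √(vol B̄_{8L}) √(∫_{S_L} ‖V‖²)`,
`N_L = ‖V‖₂²/(2π (L/8)³)`.  The tree's `shell_pressure_le` is the case of a pointwise growth bound,
`√(∫_T‖V‖⁴) ≤ C_up(32L)^{1−δ} √(∫_T‖V‖²)`; the body is the tree's, verbatim but for the mid piece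
(adapted from `…SelfSimilarEndpointPressure`).
[cite: ChaeShvydkoy2013, §3.1 proof of Thm. 3.1 (pressure terms of (3.3))] -/
theorem shell_pressure_le_of_memLp_four {C_S : ℝ≥0}
    (hCS : ∀ w : EuclideanSpace ℝ (Fin 3) → EuclideanSpace ℝ (Fin 3), MemLp w 3 volume →
      MemLp w 4 volume → eLpNorm (rieszPressure w) 2 volume ≤ C_S * eLpNorm w 4 volume ^ 2)
    (hVm : AEStronglyMeasurable V volume) (hV2 : Integrable (fun z => ‖V z‖ ^ 2) volume)
    (hV3 : LocallyIntegrable (fun y => ‖V y‖ ^ 3) volume)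
    (hPV : LocallyIntegrable (fun y => |P y| * ‖V y‖) volume)
    {L : ℝ} (hL : 0 < L)
    (hmid4 : MemLp ({y : EuclideanSpace ℝ (Fin 3) | L / 8 ≤ ‖y‖ ∧ ‖y‖ < 32 * L}.indicator V) 4 volume)
    (hP : ∀ᵐ y ∂volume, ‖y‖ < 16 * L →
      P y = rieszPressure ((ball (0 : EuclideanSpace ℝ (Fin 3)) (32 * L)).indicator V) y +
        ∫ z in {z | 32 * L ≤ ‖z‖}, pressureKernel (y - z) (V z)) :
    ∫ y in {y | L / 4 ≤ ‖y‖ ∧ ‖y‖ ≤ 8 * L}, |P y| * ‖V y‖ ≤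
      C_S * Real.sqrt (∫ y in {y | L / 8 ≤ ‖y‖ ∧ ‖y‖ < 32 * L}, ‖V y‖ ^ 4) *
          Real.sqrt (∫ y in {y | L / 4 ≤ ‖y‖ ∧ ‖y‖ ≤ 8 * L}, ‖V y‖ ^ 2) +
        2 * ((∫ z, ‖V z‖ ^ 2) / (2 * Real.pi * (L / 8) ^ 3)) *
          Real.sqrt (volume.real (closedBall (0 : EuclideanSpace ℝ (Fin 3)) (8 * L))) *
          Real.sqrt (∫ y in {y | L / 4 ≤ ‖y‖ ∧ ‖y‖ ≤ 8 * L}, ‖V y‖ ^ 2) := by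
  -- the sets
  set S : Set (EuclideanSpace ℝ (Fin 3)) := {y | L / 4 ≤ ‖y‖ ∧ ‖y‖ ≤ 8 * L} with hSdef
  set T : Set (EuclideanSpace ℝ (Fin 3)) := {y | L / 8 ≤ ‖y‖ ∧ ‖y‖ < 32 * L} with hTdef
  have hS : MeasurableSet S := (measurableSet_le measurable_const measurable_norm).inter
    (measurableSet_le measurable_norm measurable_const)
  have hT : MeasurableSet T := (measurableSet_le measurable_const measurable_norm).inter
    (measurableSet_lt measurable_norm measurable_const)
  have hST : S ⊆ T := fun y hy => ⟨by linarith [hy.1], by linarith [hy.2]⟩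
  have hTR : T ⊆ closedBall (0 : EuclideanSpace ℝ (Fin 3)) (32 * L) := fun y hy => by
    rw [mem_closedBall, dist_zero_right]; exact hy.2.le
  have hS8 : S ⊆ closedBall (0 : EuclideanSpace ℝ (Fin 3)) (8 * L) := fun y hy => by
    rw [mem_closedBall, dist_zero_right]; exact hy.2
  have hμS : volume S ≠ ⊤ := (lt_of_le_of_lt (measure_mono hS8) measure_closedBall_lt_top).ne
  -- the three source fields
  set Unear := (ball (0 : EuclideanSpace ℝ (Fin 3)) (L / 8)).indicator V with hUnear
  set Umid := T.indicator V with hUmid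
  set U32 := (ball (0 : EuclideanSpace ℝ (Fin 3)) (32 * L)).indicator V with hU32
  have hnear3 : MemLp Unear 3 volume :=
    memLp_indicator_three_of_subset hVm hV3 measurableSet_ball ball_subset_closedBall
  have h32_3 : MemLp U32 3 volume :=
    memLp_indicator_three_of_subset hVm hV3 measurableSet_ball ball_subset_closedBall
  -- the mid source is in `L³ ∩ L⁴`
  have hμT : volume T ≠ ⊤ := (lt_of_le_of_lt (measure_mono hTR) measure_closedBall_lt_top).ne
  have hmid3 : MemLp Umid 3 volume := memLp_indicator_three_of_subset hVm hV3 hT hTR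
  have hmid4' : MemLp Umid 4 volume := hmid4
  -- additivity `Π[U32] = Π[Unear] + Π[Umid]` a.e.
  have hsplit : rieszPressure U32 =ᵐ[volume] fun y => rieszPressure Unear y + rieszPressure Umid y := by
    refine rieszPressure_add_ae_eq_of_disjoint h32_3 hnear3 hmid3 (fun y => ?_)
      (Eventually.of_forall fun y => ?_)
    · by_cases hy : y ∈ ball (0 : EuclideanSpace ℝ (Fin 3)) (L / 8)
      · right
        rw [hUmid, indicator_of_notMem]
        intro hyT
        rw [mem_ball, dist_zero_right] at hy
        linarith [hyT.1]
      · left; rw [hUnear, indicator_of_notMem hy]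
    · show U32 y = Unear y + Umid y
      by_cases h1 : y ∈ ball (0 : EuclideanSpace ℝ (Fin 3)) (L / 8)
      · have h1' : ‖y‖ < L / 8 := by rwa [mem_ball, dist_zero_right] at h1
        have h32 : y ∈ ball (0 : EuclideanSpace ℝ (Fin 3)) (32 * L) := by
          rw [mem_ball, dist_zero_right]; linarith
        have hT' : y ∉ T := fun h => by linarith [h.1]
        rw [hU32, hUnear, hUmid, indicator_of_mem h32, indicator_of_mem h1,
          indicator_of_notMem hT', add_zero]
      · have h1' : L / 8 ≤ ‖y‖ := by rwa [mem_ball, dist_zero_right, not_lt] at h1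
        by_cases h2 : ‖y‖ < 32 * L
        · have h32 : y ∈ ball (0 : EuclideanSpace ℝ (Fin 3)) (32 * L) := by
            rwa [mem_ball, dist_zero_right]
          rw [hU32, hUnear, hUmid, indicator_of_mem h32, indicator_of_notMem h1,
            indicator_of_mem (show y ∈ T from ⟨h1', h2⟩), zero_add]
        · have h32 : y ∉ ball (0 : EuclideanSpace ℝ (Fin 3)) (32 * L) := by
            rwa [mem_ball, dist_zero_right]
          have hT' : y ∉ T := fun h => h2 h.2
          rw [hU32, hUnear, hUmid, indicator_of_notMem h32, indicator_of_notMem h1,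
            indicator_of_notMem hT', add_zero]
  -- the pointwise bound `|P| ≤ |Π[Umid]| + 2N` a.e. on `S`
  set N : ℝ := (∫ z, ‖V z‖ ^ 2) / (2 * Real.pi * (L / 8) ^ 3) with hNdef
  have hN0 : 0 ≤ N := by
    rw [hNdef]; exact div_nonneg (integral_nonneg fun z => by positivity) (by positivity)
  have hptS : ∀ᵐ y ∂volume, y ∈ S →
      |P y| * ‖V y‖ ≤ |rieszPressure Umid y| * ‖V y‖ + 2 * N * ‖V y‖ := by
    filter_upwards [hP, hsplit, ae_abs_near_add_far_le hV2 hL hnear3] with y hPy hsy hnf hyS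
    have hy16 : ‖y‖ < 16 * L := by linarith [hyS.2]
    have hnf' := hnf hyS.1 hyS.2
    rw [hPy hy16, hsy]
    have htri : |rieszPressure Unear y + rieszPressure Umid y +
        ∫ z in {z | 32 * L ≤ ‖z‖}, pressureKernel (y - z) (V z)| ≤
        |rieszPressure Umid y| + (|rieszPressure Unear y| +
          |∫ z in {z | 32 * L ≤ ‖z‖}, pressureKernel (y - z) (V z)|) := by
      have := abs_add_le (rieszPressure Unear y + rieszPressure Umid y)
        (∫ z in {z | 32 * L ≤ ‖z‖}, pressureKernel (y - z) (V z))
      have := abs_add_le (rieszPressure Unear y) (rieszPressure Umid y)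
      linarith
    calc |rieszPressure Unear y + rieszPressure Umid y +
          ∫ z in {z | 32 * L ≤ ‖z‖}, pressureKernel (y - z) (V z)| * ‖V y‖
        ≤ (|rieszPressure Umid y| + 2 * N) * ‖V y‖ := by
          refine mul_le_mul_of_nonneg_right (htri.trans ?_) (norm_nonneg _)
          linarith
      _ = |rieszPressure Umid y| * ‖V y‖ + 2 * N * ‖V y‖ := by ring
  -- integrability on `S`
  have hV2T : IntegrableOn (fun y => ‖V y‖ ^ 2) T volume := hV2.integrableOn
  have hV2S : MemLp V 2 (volume.restrict S) :=
    (memLp_two_iff_integrable_sq_norm hVm.restrict).2 (hV2.integrableOn)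
  have hQm : AEStronglyMeasurable (rieszPressure Umid) volume := aestronglyMeasurable_rieszPressure hmid3
  have hQ2 : MemLp (rieszPressure Umid) 2 volume := by
    refine ⟨hQm, lt_of_le_of_lt (hCS Umid hmid3 hmid4') ?_⟩
    exact ENNReal.mul_lt_top ENNReal.coe_lt_top (ENNReal.pow_lt_top hmid4'.eLpNorm_lt_top)
  haveI : IsFiniteMeasure (volume.restrict S) := isFiniteMeasure_restrict.2 hμS
  have hV1S : Integrable (fun y => ‖V y‖) (volume.restrict S) := hV2S.norm.integrable one_le_two
  have hint1 : IntegrableOn (fun y => |rieszPressure Umid y| * ‖V y‖) S volume := by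
    have h := (hQ2.restrict S).norm.integrable_mul hV2S.norm
    rw [IntegrableOn]
    convert h using 1
    funext y
    simp only [Pi.mul_apply, Real.norm_eq_abs]
  have hintLHS : IntegrableOn (fun y => |P y| * ‖V y‖) S volume :=
    (hPV.integrableOn_isCompact (isCompact_closedBall 0 (8 * L))).mono_set hS8
  -- integrate the pointwise bound
  have hI : ∫ y in S, |P y| * ‖V y‖ ≤
      (∫ y in S, |rieszPressure Umid y| * ‖V y‖) + 2 * N * ∫ y in S, ‖V y‖ := by
    rw [← integral_const_mul, ← integral_add hint1 (hV1S.const_mul _)]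
    exact setIntegral_mono_on_ae hintLHS (hint1.add (hV1S.const_mul _)) hS hptS
  -- the two pieces
  have hmid := setIntegral_abs_rieszPressure_mul_norm_le_of_memLp_four hCS hVm hT hST
    hmid3 hmid4' hV2T
  have hone : ∫ y in S, ‖V y‖ ≤ Real.sqrt (volume.real S) *
      Real.sqrt (∫ y in S, ‖V y‖ ^ 2) := by
    have h := setIntegral_abs_mul_norm_le_sqrt (S := S) (f := fun _ => (1 : ℝ))
      (memLp_const 1) hV2S
    simp only [abs_one, one_mul, one_pow, setIntegral_const, smul_eq_mul, mul_one] at h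
    exact h
  have hvol : Real.sqrt (volume.real S) ≤
      Real.sqrt (volume.real (closedBall (0 : EuclideanSpace ℝ (Fin 3)) (8 * L))) :=
    Real.sqrt_le_sqrt (measureReal_mono hS8 measure_closedBall_lt_top.ne)
  calc ∫ y in S, |P y| * ‖V y‖
      ≤ (∫ y in S, |rieszPressure Umid y| * ‖V y‖) + 2 * N * ∫ y in S, ‖V y‖ := hI
    _ ≤ C_S * Real.sqrt (∫ y in T, ‖V y‖ ^ 4) * Real.sqrt (∫ y in S, ‖V y‖ ^ 2) +
          2 * N * (Real.sqrt (volume.real (closedBall (0 : EuclideanSpace ℝ (Fin 3)) (8 * L))) *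
            Real.sqrt (∫ y in S, ‖V y‖ ^ 2)) := by
        gcongr
        exact hone.trans (mul_le_mul_of_nonneg_right hvol (Real.sqrt_nonneg _))
    _ = C_S * Real.sqrt (∫ y in T, ‖V y‖ ^ 4) * Real.sqrt (∫ y in S, ‖V y‖ ^ 2) +
          2 * ((∫ z, ‖V z‖ ^ 2) / (2 * Real.pi * (L / 8) ^ 3)) *
            Real.sqrt (volume.real (closedBall (0 : EuclideanSpace ℝ (Fin 3)) (8 * L))) *
            Real.sqrt (∫ y in S, ‖V y‖ ^ 2) := by
        rw [hNdef]; ring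

end Shell

end EndpointSobolev

end Summit.NavierStokesRegularity.NavierStokesRegularity.Theorems.PowerGaugeEulerLiouville
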